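import Mathlib
import HarnessLib
import Summits.HubbardSuperconductivity.HubbardSuperconductivity.Theorems.KLProgrammeKLRegimeEngineV8TowerCoreDefsC
import Summits.HubbardSuperconductivity.HubbardSuperconductivity.Theorems.KLProgrammeKLRegimeEngineTowerLevelsOfExport
import Summits.HubbardSuperconductivity.HubbardSuperconductivity.Theorems.KLProgrammeKLRegimeEngineV8DefsG14

/-!
# Route `KLProgramme` — crux K3 ENGINE (stmt-HubbardSuperconductivity-20437 `KLRegimeEngineV17F2`), stub (b) v2: THE TOWER CORE PACKAGE FROM A WEIGHTED-ONLY STEP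
# AND THE E4 PACK («(b)-CLOSER CENSUS» U-3/U-4; cell gate-hubbard-kl, seat gate-hubbard-kl-p3 g23)

WHY.  The (b) closer `EngineV8.A24A25ZG14.stub_engine_step_norms_of_producers hexT hexI hexG` reads `hexT`, the atom-free core package
`∃ e, IsTowerPkgC e ∧ [e.1 ≤ klEngQ9cCE P R ∧] TowerCoreStepV2 G P R (klEngQ8 P R) e.1 e.2.1 e.2.2` (`G = klEngGeo14`; capped under r16 V1, uncapped under the α1 token),
`TowerCoreStepV2 = TowerLevelsStepV2 ∧ TowerFirstMomentsStepV2` (…TowerCoreDefsC).  By `kernelNormsLevels_flow_of_hlevU` (…TowerLevelsOfExport) the LEVELS conjunct of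
`TowerLevelsStepV2` is a function of its own export binder `hlevU` once `CEᵤ P R := max 1 (klCU2 P R (klEngQ7 P R) 3) · max 1 (klCUA2 P R (klEngQ7 P R)) ≤ CE`.  Hence the
tower lane owes ONLY the WEIGHTED conjunct: this file states that weighted-only step ON `TowerLevelsStepV2`'S OWN BINDER LIST (inline, no new predicate) and assembles:
* `towerLevelsStepV2_of_weighted` — `CEᵤ ≤ CE` + the weighted-only step at `(CE, u, cT)` ⟹ `TowerLevelsStepV2 G P R (klEngQ8 P R) CE u cT`;
* `exists_towerLevelsPkgV2_of_weighted` — a weighted-only PACKAGE `∃ e, IsTowerPkgC e ∧ (weighted step at e)` ⟹ the levels package with constant `max CEᵤ e.1` (same `u`, `cT`);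
* `exists_towerCorePkgV2_of_weighted_e4` / `…_capped` — with W3's class-#4 witness `∃ Eu, … E4FlowAt …` (via `exists_towerCorePkgV2_of_levels_e4[_capped]`): the UNCAPPED core
  package (the α1 `hexT` shape at `G`) resp. the CAPPED one under the explicit hypothesis `max CEᵤ e.1 ≤ B` (the r16-V1 cap `B = klEngQ9cCE P R` is (J3)'s joint — not claimed here);
* `hexT_uncapped_of_weighted_e4_klEngGeo14` — the instance at `klEngGeo14` in the closer's binder shape `∀ P R, P.WF → R.WF2 → ∃ e, IsTowerPkgC e ∧ TowerCoreStepV2 klEngGeo14 …`.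
Bookkeeping compositions; the weighted step and the E4 pack are HYPOTHESES; nothing asserts (b), (X).1, any stub, K3 or superconductivity.
References: BGM 2006 §2.8 (2.76)–(2.84), Lemma 2.5 (2.98), §3 (3.2)–(3.8) [cite: BenfattoGiulianiMastropietro2006].
-/

noncomputable section

namespace Summit.HubbardSuperconductivity.HubbardSuperconductivity.Theorems.EngineV8

set_option linter.dupNamespace false -- summit = problem name (single-conjunct summit), D-0017

open Real Finset Literature.MathematicalPhysics.QuantumLattice Literature.Probability.LatticeModels
open Literature.MathematicalPhysics.QuantumLattice.FermiRG
open Summit.HubbardSuperconductivity.HubbardSuperconductivity.Theorems.KLRegimeSplit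
open Summit.HubbardSuperconductivity.HubbardSuperconductivity.Theorems.KLProgrammeLegKernels
open Summit.HubbardSuperconductivity.HubbardSuperconductivity.Theorems.DispersionFlow

/-! ## §1 The levels step from a weighted-only step on the same binders -/

/-- **`TowerLevelsStepV2` FROM A WEIGHTED-ONLY STEP**: if the package constant dominates the class-#1 envelope (`CEᵤ ≤ CE`) and, on `TowerLevelsStepV2`'s own binder list,
the WEIGHTED conjunct `KernelNormsWt4 L M (klWtBudget P Q U j) β U μ (K_n) j` holds at every `1 ≤ j ≤ n`, then `TowerLevelsStepV2 G P R (klEngQ8 P R) CE u cT`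
(the levels conjunct is `kernelNormsLevels_flow_of_hlevU`). [cite: BenfattoGiulianiMastropietro2006, Lemma 2.5 (2.98), §3 (3.2)-(3.8)] -/
theorem towerLevelsStepV2_of_weighted (G : GeoConsts) (P : SplitConsts) (R : RenConsts) (hP : P.WF) {CE : ℝ} {u : EngConsts → ℝ → ℝ} {cT : ℝ}
    (hCEu : max 1 (klCU2 P R (klEngQ7 P R) 3) * max 1 (klCUA2 P R (klEngQ7 P R)) ≤ CE)
    (hW : ∀ Q : EngConsts, (klEngQ8 P R).IsRaiseOf Q → CE ≤ Q.CE →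
      ∀ cc : ℝ, 0 < cc → cc ≤ klEngC₃6 P R → cc ≤ cT →
      ∀ μ ∈ klWindowC, ∀ U : ℝ, 0 < U → U ≤ klEngU₀10 P R cc → U ≤ u Q cc →
      ∀ β : ℝ, klBetaMin ≤ β → β ≤ Real.exp (cc / U ^ 2) →
      ∀ (L M : ℕ) [NeZero L] [NeZero M], klEngL₄ P R β U ≤ L → klEngM₃ β U L ≤ M →
      ∀ n : ℕ, 1 ≤ n → n ≤ nScales β + 1 → IsKLRegime U cc (-(n : ℤ)) →
      HistP klPredsV17F2 L M G P Q R β U μ 0 n →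
      (∀ m, 1 ≤ m → m < n → FlowPieceOscAt L M (klReadOscC P R) β U μ m) →
      FrameOK R U (nScales β) μ (klFlowFrameU L M β U μ n) →
      (∀ j ≤ n, LevelsUExportMixedAt L M (klCU2 P R (klEngQ7 P R)) P β U μ j) →
      ∀ j : ℕ, 1 ≤ j → j ≤ n → KernelNormsWt4 L M (klWtBudget P Q U j) β U μ (klFlowFrameU L M β U μ n) j) :
    TowerLevelsStepV2 G P R (klEngQ8 P R) CE u cT := by
  intro Q hQ hCE cc hcc hcc6 hccT μ hμ U hU hU10 hUu β hβ hβc L M _ _ hL hM n hn1 hn hreg hhist hosc hfr hlevU j hj1 hj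
  exact ⟨kernelNormsLevels_flow_of_hlevU P R hP (hCEu.trans hCE) hlevU j hj,
    hW Q hQ hCE cc hcc hcc6 hccT μ hμ U hU hU10 hUu β hβ hβc L M hL hM n hn1 hn hreg hhist hosc hfr hlevU j hj1 hj⟩

/-! ## §2 Packages -/

/-- **THE LEVELS PACKAGE FROM A WEIGHTED-ONLY PACKAGE** (constant `max CEᵤ e.1`, same thresholds): the weighted step is antitone in the set of admissible `Q`,
so raising its constant to `max CEᵤ e.1` keeps it. [cite: BenfattoGiulianiMastropietro2006, Lemma 2.5 (2.98), §3 (3.2)-(3.8)] -/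
theorem exists_towerLevelsPkgV2_of_weighted (G : GeoConsts) (P : SplitConsts) (R : RenConsts) (hP : P.WF)
    (hW : ∃ e : ℝ × (EngConsts → ℝ → ℝ) × ℝ, IsTowerPkgC e ∧
      ∀ Q : EngConsts, (klEngQ8 P R).IsRaiseOf Q → e.1 ≤ Q.CE →
      ∀ cc : ℝ, 0 < cc → cc ≤ klEngC₃6 P R → cc ≤ e.2.2 →
      ∀ μ ∈ klWindowC, ∀ U : ℝ, 0 < U → U ≤ klEngU₀10 P R cc → U ≤ e.2.1 Q cc →
      ∀ β : ℝ, klBetaMin ≤ β → β ≤ Real.exp (cc / U ^ 2) →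
      ∀ (L M : ℕ) [NeZero L] [NeZero M], klEngL₄ P R β U ≤ L → klEngM₃ β U L ≤ M →
      ∀ n : ℕ, 1 ≤ n → n ≤ nScales β + 1 → IsKLRegime U cc (-(n : ℤ)) →
      HistP klPredsV17F2 L M G P Q R β U μ 0 n →
      (∀ m, 1 ≤ m → m < n → FlowPieceOscAt L M (klReadOscC P R) β U μ m) →
      FrameOK R U (nScales β) μ (klFlowFrameU L M β U μ n) →
      (∀ j ≤ n, LevelsUExportMixedAt L M (klCU2 P R (klEngQ7 P R)) P β U μ j) →
      ∀ j : ℕ, 1 ≤ j → j ≤ n → KernelNormsWt4 L M (klWtBudget P Q U j) β U μ (klFlowFrameU L M β U μ n) j) :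
    ∃ e : ℝ × (EngConsts → ℝ → ℝ) × ℝ, IsTowerPkgC e ∧
      e.1 = max (max 1 (klCU2 P R (klEngQ7 P R) 3) * max 1 (klCUA2 P R (klEngQ7 P R))) (Classical.choose hW).1 ∧
      TowerLevelsStepV2 G P R (klEngQ8 P R) e.1 e.2.1 e.2.2 := by
  obtain ⟨⟨hW0, hWu, hWc⟩, hstep⟩ := Classical.choose_spec hW
  refine ⟨(max (max 1 (klCU2 P R (klEngQ7 P R) 3) * max 1 (klCUA2 P R (klEngQ7 P R))) (Classical.choose hW).1,
    (Classical.choose hW).2.1, (Classical.choose hW).2.2), ⟨le_max_of_le_right hW0, hWu, hWc⟩, rfl, ?_⟩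
  exact towerLevelsStepV2_of_weighted G P R hP (le_max_left _ _)
    fun Q hQ hCE => hstep Q hQ ((le_max_right _ _).trans hCE)

/-- **THE UNCAPPED CORE PACKAGE (the α1 `hexT` shape at `G`) FROM A WEIGHTED-ONLY PACKAGE AND THE E4 PACK** — any well-formed `G` with `klE4TF ≤ G.cE4`.
[cite: BenfattoGiulianiMastropietro2006, Lemma 2.5 (2.98), §3 (3.2)-(3.8)] -/
theorem exists_towerCorePkgV2_of_weighted_e4 (G : GeoConsts) (hG : G.WF) (hcE4 : klE4TF ≤ G.cE4) (P : SplitConsts) (R : RenConsts) (hP : P.WF) (hR : R.WF2)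
    (hW : ∃ e : ℝ × (EngConsts → ℝ → ℝ) × ℝ, IsTowerPkgC e ∧
      ∀ Q : EngConsts, (klEngQ8 P R).IsRaiseOf Q → e.1 ≤ Q.CE →
      ∀ cc : ℝ, 0 < cc → cc ≤ klEngC₃6 P R → cc ≤ e.2.2 →
      ∀ μ ∈ klWindowC, ∀ U : ℝ, 0 < U → U ≤ klEngU₀10 P R cc → U ≤ e.2.1 Q cc →
      ∀ β : ℝ, klBetaMin ≤ β → β ≤ Real.exp (cc / U ^ 2) →
      ∀ (L M : ℕ) [NeZero L] [NeZero M], klEngL₄ P R β U ≤ L → klEngM₃ β U L ≤ M →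
      ∀ n : ℕ, 1 ≤ n → n ≤ nScales β + 1 → IsKLRegime U cc (-(n : ℤ)) →
      HistP klPredsV17F2 L M G P Q R β U μ 0 n →
      (∀ m, 1 ≤ m → m < n → FlowPieceOscAt L M (klReadOscC P R) β U μ m) →
      FrameOK R U (nScales β) μ (klFlowFrameU L M β U μ n) →
      (∀ j ≤ n, LevelsUExportMixedAt L M (klCU2 P R (klEngQ7 P R)) P β U μ j) →
      ∀ j : ℕ, 1 ≤ j → j ≤ n → KernelNormsWt4 L M (klWtBudget P Q U j) β U μ (klFlowFrameU L M β U μ n) j)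
    (hE : ∃ Eu : ℝ × (GeoConsts → SplitConsts → RenConsts → EngConsts → ℝ → ℝ),
      0 ≤ Eu.1 ∧ (∀ G P R Q cc, 0 < Eu.2 G P R Q cc) ∧ E4FlowAt Eu.1 Eu.2) :
    ∃ e : ℝ × (EngConsts → ℝ → ℝ) × ℝ, IsTowerPkgC e ∧ TowerCoreStepV2 G P R (klEngQ8 P R) e.1 e.2.1 e.2.2 := by
  obtain ⟨e, he, -, hℓ⟩ := exists_towerLevelsPkgV2_of_weighted G P R hP hW
  exact exists_towerCorePkgV2_of_levels_e4 G hG hcE4 hP hR (isRaiseOf_klEngQ8 P R) ⟨e, he, hℓ⟩ hE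

/-- **THE CAPPED CORE PACKAGE FROM A WEIGHTED-ONLY PACKAGE AND THE E4 PACK** — under the EXPLICIT cap hypothesis `max CEᵤ (the weighted constant) ≤ B` (at
`B = klEngQ9cCE P R` this is the registrant joint (J3), not claimed here). [cite: BenfattoGiulianiMastropietro2006, Lemma 2.5 (2.98), §3 (3.2)-(3.8)] -/
theorem exists_towerCorePkgV2_of_weighted_e4_capped (G : GeoConsts) (hG : G.WF) (hcE4 : klE4TF ≤ G.cE4) (P : SplitConsts) (R : RenConsts) (hP : P.WF)
    (hR : R.WF2) {B : ℝ}
    (hW : ∃ e : ℝ × (EngConsts → ℝ → ℝ) × ℝ, IsTowerPkgC e ∧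
      ∀ Q : EngConsts, (klEngQ8 P R).IsRaiseOf Q → e.1 ≤ Q.CE →
      ∀ cc : ℝ, 0 < cc → cc ≤ klEngC₃6 P R → cc ≤ e.2.2 →
      ∀ μ ∈ klWindowC, ∀ U : ℝ, 0 < U → U ≤ klEngU₀10 P R cc → U ≤ e.2.1 Q cc →
      ∀ β : ℝ, klBetaMin ≤ β → β ≤ Real.exp (cc / U ^ 2) →
      ∀ (L M : ℕ) [NeZero L] [NeZero M], klEngL₄ P R β U ≤ L → klEngM₃ β U L ≤ M →
      ∀ n : ℕ, 1 ≤ n → n ≤ nScales β + 1 → IsKLRegime U cc (-(n : ℤ)) →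
      HistP klPredsV17F2 L M G P Q R β U μ 0 n →
      (∀ m, 1 ≤ m → m < n → FlowPieceOscAt L M (klReadOscC P R) β U μ m) →
      FrameOK R U (nScales β) μ (klFlowFrameU L M β U μ n) →
      (∀ j ≤ n, LevelsUExportMixedAt L M (klCU2 P R (klEngQ7 P R)) P β U μ j) →
      ∀ j : ℕ, 1 ≤ j → j ≤ n → KernelNormsWt4 L M (klWtBudget P Q U j) β U μ (klFlowFrameU L M β U μ n) j)
    (hB : max (max 1 (klCU2 P R (klEngQ7 P R) 3) * max 1 (klCUA2 P R (klEngQ7 P R))) (Classical.choose hW).1 ≤ B)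
    (hE : ∃ Eu : ℝ × (GeoConsts → SplitConsts → RenConsts → EngConsts → ℝ → ℝ),
      0 ≤ Eu.1 ∧ (∀ G P R Q cc, 0 < Eu.2 G P R Q cc) ∧ E4FlowAt Eu.1 Eu.2) :
    ∃ e : ℝ × (EngConsts → ℝ → ℝ) × ℝ, IsTowerPkgC e ∧ e.1 ≤ B ∧ TowerCoreStepV2 G P R (klEngQ8 P R) e.1 e.2.1 e.2.2 := by
  obtain ⟨e, he, he1, hℓ⟩ := exists_towerLevelsPkgV2_of_weighted G P R hP hW
  exact exists_towerCorePkgV2_of_levels_e4_capped G hG hcE4 hP hR (isRaiseOf_klEngQ8 P R) ⟨e, he, he1 ▸ hB, hℓ⟩ hE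

/-! ## §3 The instance at `klEngGeo14` in the closer's binder shape -/

/-- **`hexT` UNCAPPED AT `klEngGeo14` (the α1 closer's first producer) FROM A WEIGHTED-ONLY PACKAGE FAMILY AND THE E4 PACK.**
[cite: BenfattoGiulianiMastropietro2006, Lemma 2.5 (2.98), §3 (3.2)-(3.8)] -/
theorem hexT_uncapped_of_weighted_e4_klEngGeo14
    (hW : ∀ (P : SplitConsts) (R : RenConsts), P.WF → R.WF2 → ∃ e : ℝ × (EngConsts → ℝ → ℝ) × ℝ, IsTowerPkgC e ∧
      ∀ Q : EngConsts, (klEngQ8 P R).IsRaiseOf Q → e.1 ≤ Q.CE →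
      ∀ cc : ℝ, 0 < cc → cc ≤ klEngC₃6 P R → cc ≤ e.2.2 →
      ∀ μ ∈ klWindowC, ∀ U : ℝ, 0 < U → U ≤ klEngU₀10 P R cc → U ≤ e.2.1 Q cc →
      ∀ β : ℝ, klBetaMin ≤ β → β ≤ Real.exp (cc / U ^ 2) →
      ∀ (L M : ℕ) [NeZero L] [NeZero M], klEngL₄ P R β U ≤ L → klEngM₃ β U L ≤ M →
      ∀ n : ℕ, 1 ≤ n → n ≤ nScales β + 1 → IsKLRegime U cc (-(n : ℤ)) →
      HistP klPredsV17F2 L M klEngGeo14 P Q R β U μ 0 n →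
      (∀ m, 1 ≤ m → m < n → FlowPieceOscAt L M (klReadOscC P R) β U μ m) →
      FrameOK R U (nScales β) μ (klFlowFrameU L M β U μ n) →
      (∀ j ≤ n, LevelsUExportMixedAt L M (klCU2 P R (klEngQ7 P R)) P β U μ j) →
      ∀ j : ℕ, 1 ≤ j → j ≤ n → KernelNormsWt4 L M (klWtBudget P Q U j) β U μ (klFlowFrameU L M β U μ n) j)
    (hE : ∃ Eu : ℝ × (GeoConsts → SplitConsts → RenConsts → EngConsts → ℝ → ℝ),
      0 ≤ Eu.1 ∧ (∀ G P R Q cc, 0 < Eu.2 G P R Q cc) ∧ E4FlowAt Eu.1 Eu.2) :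
    ∀ (P : SplitConsts) (R : RenConsts), P.WF → R.WF2 →
      ∃ e : ℝ × (EngConsts → ℝ → ℝ) × ℝ, IsTowerPkgC e ∧ TowerCoreStepV2 klEngGeo14 P R (klEngQ8 P R) e.1 e.2.1 e.2.2 :=
  fun P R hP hR => exists_towerCorePkgV2_of_weighted_e4 klEngGeo14 klEngGeo14_wf klE4TF_le_klEngGeo14_cE4 P R hP hR (hW P R hP hR) hE

end Summit.HubbardSuperconductivity.HubbardSuperconductivity.Theorems.EngineV8

end
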